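import Literature.ComputerArithmetic.HighamMary2020.GeneralData

/-!
# Higham–Mary (2020), §2.2: probabilistic backward error analysis of recursive summation for
# RANDOM DATA (Models 2 and 3, Lemmas 2.5–2.7 and 2.9, Theorem 2.8, Corollary 2.10)

N. J. Higham, T. Mary, *Sharper probabilistic backward error analysis for basic linear algebra
kernels with random data*, SIAM J. Sci. Comput. 42 (5) (2020) A3427–A3446,
doi:10.1137/20M1314355 — Section 2.2 "Probabilistic analysis for random data", the paper's main
device: a probabilistic model of the DATA explains why the backward error of recursive summation
grows like `√n u` for data with nonzero mean but stays `O(u)` for zero-mean data.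

* MODEL 2 (probabilistic model of the data): the `x_j` are independent random variables sampled
  from a distribution of mean `μ_x`, with `|x_j| ≤ C_x` (`Model2 μ ξ m C`: an independent family of
  measurable, uniformly bounded random variables with common mean `m`).
* MODEL 3 (rounding errors mean independent of the previous rounding errors AND of the data):
  `E(δ_k | δ_2, …, δ_{k−1}, x_1, …, x_n) = E(δ_k) = 0`, `|δ_k| ≤ u` (`Model3 μ u δ ξ`, in the
  test-function form of the tree's Model 1 = `ConnollyHighamMary2021.SRErrorModel`: for every bounded
  measurable `G` of the earlier rounding errors and of the whole data vector,
  `E[G(δ_<k, x) δ_k] = 0`). `Model3.toSRErrorModel`: Model 3 implies Model 1. THE REDUCTION that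
  carries the martingale argument of Lemma 2.7 (a martingale with respect to `T_1 δ_1, …, T_n δ_n`)
  back to the tree's Azuma–Hoeffding inequality for Model 1 (`HallmanIpsen2023.azumaHoeffding`):
  rounding errors RESCALED by data- and past-dependent factors of modulus `≤ 1` again satisfy
  Model 1 (`Model3.srErrorModel_mul`).
* LEMMA 2.5 (Hoeffding's inequality, two-sided, `|X_i| ≤ c_i`): from Mathlib's Hoeffding lemma
  `hasSubgaussianMGF_of_mem_Icc` and `HasSubgaussianMGF.measure_sum_ge_le_of_iIndepFun`
  (`hoeffding_abs`).
* LEMMA 2.6: `|T_i| ≤ |μ_x| i + λ C_x √i` with probability `≥ 1 − 2 exp(−λ²/2)`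
  (`Model2.partialSum_probBound`).
* LEMMA 2.7: `|E_n| ≤ (λ |μ_x| n^{3/2} + λ² C_x n) u`, `E_n = Σ_i T_i δ_i`, with probability
  `≥ 1 − 2n exp(−λ²/2)` (`firstOrder_probBound`, with the sharper intermediate form
  `λ √(n−1) (|μ_x| n + λ C_x √n) u` of the proof as `firstOrder_probBound_sharp`).
* THEOREM 2.8: `|ŝ − s| ≤ (λ |μ_x| n^{3/2} + λ² C_x n) u + O(u²)` with probability
  `≥ 1 − 2n exp(−λ²/2)` — the `O(u²)` EXPLICIT as `(n−1) n C_x ((1+u)^{n−2} − 1) u` (from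
  `GeneralData`'s `abs_sum_remCoef_mul_le`) (`recSum_probErrorBound_randomData`).
* LEMMA 2.9: `|Σ_j w_j| ≥ α |μ_w| n` with probability `≥ 1 − 2 exp(−λ²/2)` whenever
  `(1 − α) |μ_w| √n ≥ λ C_w` (`Model2.sum_lower_probBound`).
* COROLLARY 2.10: `ε_bwd(ŝ) ≤ (α μ_|x|)⁻¹ (λ |μ_x| √n + λ² C_x) u + O(u²)` with probability
  `≥ 1 − 2(n+1) exp(−λ²/2)` (`recSum_probBackwardError_randomData`, `O(u²)` explicit).

INDEXING as in `GeneralData`: data `x_0, …, x_n` (`n + 1` summands = the source's `n`), `n`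
additions with rounding errors `δ_1, …, δ_n`, `T_k = Σ_{i≤k} x_i = dataCoef x k` (`k ≥ 1`,
`dataCoef x 0 = 0`), `E_n = Σ_{k≤n} T_k δ_k`. So the source's `n`, `n^{3/2}`, `√n` read `n + 1`,
`(n+1) √(n+1)`, `√(n+1)` below, and the failure probabilities `2n exp(−λ²/2)`, `2(n+1) exp(−λ²/2)`
read `2(n+1) exp(−λ²/2)`, `2(n+2) exp(−λ²/2)`.

TYPING NOTES. (1) Lemma 2.5 / 2.6 / 2.9 are typed with the STRICT failure event
`μ {ω | bound < |·|} ≤ ENNReal.ofReal p` (the tree's convention); with `≤` in the event the printed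
(2.12) is false in the degenerate case `Σ c_i² = 0`. (2) Lemma 2.9 is printed for `α ∈ [0,1]`; the
proof uses only the displayed condition `(1−α)|μ_w| √n ≥ λ C_w`, so `α` is unrestricted there;
Corollary 2.10 needs `0 < α` (for `α = 0` the printed bound is `+∞`, i.e. vacuous, while a literal
`1/(0·μ)` would read `0` in Lean). (3) In Corollary 2.10 the source lets `|x|` "also satisfy Model 2
with mean `μ_|x|`" (same constant `C_x`); we allow its own constant `C'` in the hypothesis
`Model2 μ |ξ| mabs C'` and the condition `λ C' ≤ (1−α) mabs √(n+1)`.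

NOT typed here: §3 (inner products `recDot`, matrix–vector and matrix–matrix products:
Theorems 3.2–3.4), §4 (LU factorization, Theorem 4.1), §5 (experiments).
-/

namespace Literature.ComputerArithmetic.HighamMary2020

open MeasureTheory ProbabilityTheory Finset Real
open scoped NNReal ENNReal

open Literature.ComputerArithmetic.Higham2002 (recSum)
open Literature.ComputerArithmetic.BlanchardHighamMary2020 (IsBackwardSum)
open Literature.ComputerArithmetic.ConnollyHighamMary2021 (SRErrorModel)
open Literature.ComputerArithmetic.HallmanIpsen2023 (IsPredictable transform azumaHoeffding
  azumaRadius azumaRadius_nonneg u_nonneg clip)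

variable {Ω : Type*} [MeasurableSpace Ω] {μ : Measure Ω}

/-! ### MODEL 2 (random data) and MODEL 3 (rounding errors mean independent of the data too) -/

/-- **MODEL 2 (probabilistic model of the data).** The data `x_j` are INDEPENDENT random variables
sampled from a distribution of mean `m = μ_x` and satisfy `|x_j| ≤ C = C_x` (typed for a family
indexed by any type `ι`: independence of the family, measurability, common mean `m`, uniform bound
`C`). [cite: HighamMary2020, §2.2, Model 2 (probabilistic model of the data)] -/
structure Model2 (μ : Measure Ω) {ι : Type*} (ξ : ι → Ω → ℝ) (m C : ℝ) : Prop where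
  indep : iIndepFun ξ μ
  measurable : ∀ j, Measurable (ξ j)
  integral_eq : ∀ j, ∫ ω, ξ j ω ∂μ = m
  bounded : ∀ j ω, |ξ j ω| ≤ C

/-- **MODEL 3 (modified probabilistic model of rounding errors for recursive summation).** The
rounding errors `δ_k` of the summation of the random data `x = ξ` are random variables of mean zero,
bounded by `u`, and MEAN INDEPENDENT OF THE PREVIOUS ROUNDING ERRORS AND OF THE DATA:
`E(δ_k | δ_2, …, δ_{k−1}, x_1, …, x_n) = E(δ_k) = 0` — in test-function form: for every bounded
measurable function `G` of the rounding-error sequence and of the data vector that depends on the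
rounding errors only through `δ_0, …, δ_{k−1}`, `E[G(δ, x) δ_k] = 0`.
[cite: HighamMary2020, §2.2, Model 3, eq. (2.11)] -/
structure Model3 (μ : Measure Ω) (u : ℝ) (δ ξ : ℕ → Ω → ℝ) : Prop where
  measurable : ∀ k, Measurable (δ k)
  bounded : ∀ k ω, |δ k ω| ≤ u
  dataMeasurable : ∀ j, Measurable (ξ j)
  meanIndep : ∀ (k : ℕ) (G : (ℕ → ℝ) × (ℕ → ℝ) → ℝ), Measurable G →
    (∀ v w e, (∀ i < k, v i = w i) → G (v, e) = G (w, e)) → (∃ B, ∀ p, |G p| ≤ B) →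
    ∫ ω, G (fun i => δ i ω, fun j => ξ j ω) * δ k ω ∂μ = 0

namespace Model3

variable {u : ℝ} {δ ξ : ℕ → Ω → ℝ}

/-- The pair (rounding-error sequence, data vector) is a random element of `(ℕ → ℝ) × (ℕ → ℝ)`.
[cite: HighamMary2020, §2.2, Model 3 (the `δ_k` and the `x_j` are random variables)] -/
theorem measurable_pair (h : Model3 μ u δ ξ) :
    Measurable (fun ω => ((fun i => δ i ω, fun j => ξ j ω) : (ℕ → ℝ) × (ℕ → ℝ))) :=
  (measurable_pi_lambda _ h.measurable).prodMk (measurable_pi_lambda _ h.dataMeasurable)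

/-- **THE REDUCTION OF MODEL 3 TO MODEL 1.** If `φ_k = F_k(δ, x)` is a bounded-by-one measurable
functional of the EARLIER rounding errors `δ_0, …, δ_{k−1}` and of the data, then the rescaled
rounding errors `φ_k δ_k` again satisfy Model 1 (`SRErrorModel μ u`): they are measurable, bounded by
`u`, and `E[g(φ_0 δ_0, …, φ_{k−1} δ_{k−1}) φ_k δ_k] = E[G(δ, x) δ_k] = 0` with
`G = g(F_0 δ_0, …, F_{k−1} δ_{k−1}) F_k`, a bounded measurable functional of `δ_<k` and `x` — the
law-of-total-expectation step (2.13) of the proof of Lemma 2.7 ("fixing `δ_1, …, δ_{k−1}, x_1, …, x_k`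
leads to fixed `T_k` and `T_1 δ_1, …, T_{k−1} δ_{k−1}`", then (2.11)).
[cite: HighamMary2020, §2.2, Lemma 2.7, proof, eq. (2.13)] -/
theorem srErrorModel_mul (h : Model3 μ u δ ξ) {φ : ℕ → Ω → ℝ}
    {F : ℕ → (ℕ → ℝ) × (ℕ → ℝ) → ℝ} (hFm : ∀ k, Measurable (F k))
    (hFdep : ∀ k v w e, (∀ i < k, v i = w i) → F k (v, e) = F k (w, e))
    (hFbd : ∀ k p, |F k p| ≤ 1) (hφ : ∀ k ω, φ k ω = F k (fun i => δ i ω, fun j => ξ j ω)) :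
    SRErrorModel μ u (fun k ω => φ k ω * δ k ω) where
  measurable k := by
    have hφk : φ k = fun ω => F k (fun i => δ i ω, fun j => ξ j ω) := funext (hφ k)
    rw [hφk]
    exact ((hFm k).comp h.measurable_pair).mul (h.measurable k)
  bounded k ω := by
    rw [abs_mul]
    have h1 : |φ k ω| ≤ 1 := by rw [hφ k ω]; exact hFbd k _
    exact (mul_le_of_le_one_left (abs_nonneg _) h1).trans (h.bounded k ω)
  meanIndep k g hg hgb := by
    obtain ⟨B, hB⟩ := hgb
    have hB0 : 0 ≤ B := (abs_nonneg _).trans (hB fun _ => 0)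
    set G : (ℕ → ℝ) × (ℕ → ℝ) → ℝ := fun p => g (fun i : Fin k => F i p * p.1 i) * F k p with hG
    have hGm : Measurable G :=
      (hg.comp (measurable_pi_lambda _ (fun i : Fin k =>
        (hFm i).mul ((measurable_pi_apply (i : ℕ)).comp measurable_fst)))).mul (hFm k)
    have hGdep : ∀ v w e, (∀ i < k, v i = w i) → G (v, e) = G (w, e) := by
      intro v w e hvw
      simp only [hG]
      congr 1
      · congr 1
        funext i
        rw [hFdep i v w e (fun j hj => hvw j (hj.trans i.2)), hvw i i.2]
      · exact hFdep k v w e hvw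
    have hGbd : ∃ B', ∀ p, |G p| ≤ B' := ⟨B, fun p => by
      simp only [hG]
      rw [abs_mul]
      exact (mul_le_mul (hB _) (hFbd k p) (abs_nonneg _) hB0).trans_eq (mul_one B)⟩
    have h0 := h.meanIndep k G hGm hGdep hGbd
    have hint : (fun ω => g (fun i : Fin k => φ i ω * δ i ω) * (φ k ω * δ k ω))
        = fun ω => G (fun i => δ i ω, fun j => ξ j ω) * δ k ω := by
      funext ω
      simp only [hG, hφ]
      ring
    show ∫ ω, g (fun i : Fin k => φ i ω * δ i ω) * (φ k ω * δ k ω) ∂μ = 0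
    rw [hint]
    exact h0

/-- Model 3 implies Model 1 (`SRErrorModel μ u δ`): "Model 3 generalizes Model 1 by taking the
rounding errors to be mean independent of the data in addition to being mean independent of the
previous rounding errors". [cite: HighamMary2020, §2.2, Model 3 ("Model 3 generalizes Model 1 …")] -/
theorem toSRErrorModel (h : Model3 μ u δ ξ) : SRErrorModel μ u δ := by
  have h1 := h.srErrorModel_mul (φ := fun _ _ => (1 : ℝ)) (F := fun _ _ => 1)
    (fun _ => measurable_const) (fun _ _ _ _ _ => rfl) (fun _ _ => by simp) (fun _ _ => rfl)
  simpa using h1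

/-- `u ≥ 0` under Model 3 (the sample space of a probability measure is nonempty).
[cite: HighamMary2020, §2.2, Model 3 (`|δ_k| ≤ u`)] -/
theorem u_nonneg [IsProbabilityMeasure μ] (h : Model3 μ u δ ξ) : 0 ≤ u :=
  HallmanIpsen2023.u_nonneg h.toSRErrorModel

end Model3

/-! ### LEMMA 2.5 (Hoeffding's inequality) and LEMMA 2.6 (the partial sums of random data) -/

section Hoeffding

variable [IsProbabilityMeasure μ]

/-- **LEMMA 2.5 (Hoeffding's inequality), two-sided form for bounded variables.** If `X_i`,
`i ∈ s`, are independent with `|X_i| ≤ c_i`, then `S = Σ_i X_i` satisfies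
`P(|S − E S| ≥ λ (Σ_i c_i²)^{1/2}) ≤ 2 exp(−λ²/2)`; typed with the strict failure event
(`E S = Σ_i E X_i`). Proof: Mathlib's Hoeffding lemma (`X_i − E X_i` is sub-Gaussian with
parameter `((c_i − (−c_i))/2)² = c_i²`) and its Chernoff bound for independent sums, on both tails.
[cite: HighamMary2020, §2.2, Lemma 2.5, eq. (2.12) (Hoeffding's inequality [Hoeffding 1963,
Thm. 2])] -/
theorem hoeffding_abs {ι : Type*} {X : ι → Ω → ℝ} (hind : iIndepFun X μ)
    (hmeas : ∀ i, Measurable (X i)) {c : ι → ℝ} (hc : ∀ i ω, |X i ω| ≤ c i) (s : Finset ι)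
    {lam : ℝ} (hlam : 0 ≤ lam) :
    μ {ω | lam * Real.sqrt (∑ i ∈ s, c i ^ 2)
        < |∑ i ∈ s, X i ω - ∑ i ∈ s, ∫ ω', X i ω' ∂μ|}
      ≤ ENNReal.ofReal (2 * Real.exp (-lam ^ 2 / 2)) := by
  obtain ⟨ω₀⟩ := nonempty_of_isProbabilityMeasure μ
  have hc0 : ∀ i, 0 ≤ c i := fun i => (abs_nonneg _).trans (hc i ω₀)
  set mX : ι → ℝ := fun i => ∫ ω', X i ω' ∂μ with hmX
  set V : ℝ := ∑ i ∈ s, c i ^ 2 with hV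
  have hV0 : 0 ≤ V := sum_nonneg (fun i _ => sq_nonneg (c i))
  have hsum : ∀ ω, ∑ i ∈ s, X i ω - ∑ i ∈ s, mX i = ∑ i ∈ s, (X i ω - mX i) :=
    fun ω => by rw [sum_sub_distrib]
  rcases hV0.eq_or_lt with hVz | hVpos
  · -- degenerate case: every `c_i` vanishes on `s`, so `S = E S` surely and nothing can fail
    have hci : ∀ i ∈ s, c i = 0 := fun i hi =>
      pow_eq_zero_iff (n := 2) (by norm_num) |>.mp
        (((sum_eq_zero_iff_of_nonneg (fun j _ => sq_nonneg (c j))).mp hVz.symm) i hi)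
    have hX0 : ∀ i ∈ s, X i = fun _ => 0 := fun i hi =>
      funext fun ω => abs_nonpos_iff.mp ((hc i ω).trans (hci i hi).le)
    have hempty : {ω | lam * Real.sqrt V < |∑ i ∈ s, X i ω - ∑ i ∈ s, mX i|} = ∅ := by
      ext ω
      simp only [Set.mem_setOf_eq, Set.mem_empty_iff_false, iff_false, not_lt, ← hVz,
        Real.sqrt_zero, mul_zero]
      have h1 : ∑ i ∈ s, X i ω = 0 := sum_eq_zero (fun i hi => by rw [hX0 i hi])
      have h2 : ∑ i ∈ s, mX i = 0 := sum_eq_zero (fun i hi => by simp [hmX, hX0 i hi])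
      rw [h1, h2, sub_zero, abs_zero]
    rw [hempty, measure_empty]
    exact bot_le
  · set ε : ℝ := lam * Real.sqrt V with hεdef
    have hε : 0 ≤ ε := mul_nonneg hlam (Real.sqrt_nonneg _)
    have hεV : -ε ^ 2 / (2 * V) = -lam ^ 2 / 2 := by
      rw [hεdef, mul_pow, Real.sq_sqrt hV0]
      field_simp
    -- the centred variables are sub-Gaussian with parameter `((c_i − (−c_i))/2)² = c_i²`
    -- (Hoeffding's lemma)
    have hsub : ∀ i ∈ s,
        HasSubgaussianMGF (fun ω => X i ω - mX i) ((‖c i - -c i‖₊ / 2) ^ 2) μ := fun i _ =>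
      hasSubgaussianMGF_of_mem_Icc (μ := μ) (X := X i) (a := -c i) (b := c i)
        (hmeas i).aemeasurable (ae_of_all μ (fun ω => Set.mem_Icc.mpr (abs_le.mp (hc i ω))))
    have hsub' : ∀ i ∈ s,
        HasSubgaussianMGF (fun ω => -(X i ω - mX i)) ((‖c i - -c i‖₊ / 2) ^ 2) μ :=
      fun i hi => (hsub i hi).neg
    have hindY : iIndepFun (fun i ω => X i ω - mX i) μ :=
      hind.comp (fun i (x : ℝ) => x - mX i) (fun i => measurable_id.sub_const _)
    have hindY' : iIndepFun (fun i ω => -(X i ω - mX i)) μ :=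
      hind.comp (fun i (x : ℝ) => -(x - mX i)) (fun i => (measurable_id.sub_const _).neg)
    have hcsum : ((∑ i ∈ s, (‖c i - -c i‖₊ / 2) ^ 2 : ℝ≥0) : ℝ) = V := by
      rw [NNReal.coe_sum]
      refine sum_congr rfl (fun i _ => ?_)
      rw [NNReal.coe_pow, NNReal.coe_div, coe_nnnorm, Real.norm_eq_abs, NNReal.coe_ofNat,
        abs_of_nonneg (by linarith [hc0 i])]
      ring
    have hup : μ.real {ω | ε ≤ ∑ i ∈ s, (X i ω - mX i)} ≤ Real.exp (-lam ^ 2 / 2) := by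
      have h1 := HasSubgaussianMGF.measure_sum_ge_le_of_iIndepFun hindY hsub hε
      rwa [hcsum, hεV] at h1
    have hlo : μ.real {ω | ε ≤ ∑ i ∈ s, -(X i ω - mX i)} ≤ Real.exp (-lam ^ 2 / 2) := by
      have h1 := HasSubgaussianMGF.measure_sum_ge_le_of_iIndepFun hindY' hsub' hε
      rwa [hcsum, hεV] at h1
    have hsubset : {ω | ε < |∑ i ∈ s, X i ω - ∑ i ∈ s, mX i|}
        ⊆ {ω | ε ≤ ∑ i ∈ s, (X i ω - mX i)} ∪ {ω | ε ≤ ∑ i ∈ s, -(X i ω - mX i)} := by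
      intro ω hω
      simp only [Set.mem_setOf_eq, Set.mem_union] at hω ⊢
      rw [hsum ω] at hω
      rw [sum_neg_distrib]
      rcases le_or_gt 0 (∑ i ∈ s, (X i ω - mX i)) with h0 | h0
      · left; rw [abs_of_nonneg h0] at hω; exact hω.le
      · right; rw [abs_of_neg h0] at hω; exact hω.le
    have h2 : 0 ≤ Real.exp (-lam ^ 2 / 2) := (Real.exp_pos _).le
    calc μ {ω | ε < |∑ i ∈ s, X i ω - ∑ i ∈ s, mX i|}
        ≤ μ ({ω | ε ≤ ∑ i ∈ s, (X i ω - mX i)} ∪ {ω | ε ≤ ∑ i ∈ s, -(X i ω - mX i)}) :=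
          measure_mono hsubset
      _ ≤ μ {ω | ε ≤ ∑ i ∈ s, (X i ω - mX i)} + μ {ω | ε ≤ ∑ i ∈ s, -(X i ω - mX i)} :=
          measure_union_le _ _
      _ = ENNReal.ofReal (μ.real {ω | ε ≤ ∑ i ∈ s, (X i ω - mX i)})
          + ENNReal.ofReal (μ.real {ω | ε ≤ ∑ i ∈ s, -(X i ω - mX i)}) := by
          rw [ofReal_measureReal, ofReal_measureReal]
      _ ≤ ENNReal.ofReal (Real.exp (-lam ^ 2 / 2)) + ENNReal.ofReal (Real.exp (-lam ^ 2 / 2)) :=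
          add_le_add (ENNReal.ofReal_le_ofReal hup) (ENNReal.ofReal_le_ofReal hlo)
      _ = ENNReal.ofReal (2 * Real.exp (-lam ^ 2 / 2)) := by
          rw [← ENNReal.ofReal_add h2 h2, two_mul]

/-- The constant of Model 2 is nonnegative (the sample space is nonempty).
[cite: HighamMary2020, §2.2, Model 2 (`|x_j| ≤ C_x`)] -/
theorem Model2.const_nonneg {ι : Type*} [Nonempty ι] {ξ : ι → Ω → ℝ} {m C : ℝ}
    (hx : Model2 μ ξ m C) : 0 ≤ C := by
  obtain ⟨ω₀⟩ := nonempty_of_isProbabilityMeasure μ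
  obtain ⟨j⟩ := ‹Nonempty ι›
  exact (abs_nonneg _).trans (hx.bounded j ω₀)

/-- **LEMMA 2.6: the partial sums of random data.** Under Model 2, for each `i` the partial sum
`T = Σ_{j=0}^{i} x_j` (`i + 1` summands) satisfies `|T| ≤ |μ_x| (i+1) + λ C_x √(i+1)` with
probability at least `1 − 2 exp(−λ²/2)` (Lemma 2.5 with `X_j = x_j`, `E S = μ_x (i+1)`,
`c_j = C_x`). [cite: HighamMary2020, §2.2, Lemma 2.6] -/
theorem Model2.partialSum_probBound {ξ : ℕ → Ω → ℝ} {m C : ℝ} (hx : Model2 μ ξ m C) (i : ℕ)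
    {lam : ℝ} (hlam : 0 ≤ lam) :
    μ {ω | |m| * (i + 1) + lam * C * Real.sqrt (i + 1) < |∑ j ∈ range (i + 1), ξ j ω|}
      ≤ ENNReal.ofReal (2 * Real.exp (-lam ^ 2 / 2)) := by
  have hC : 0 ≤ C := hx.const_nonneg
  have hH := hoeffding_abs hx.indep hx.measurable (c := fun _ => C) (fun j ω => hx.bounded j ω)
    (range (i + 1)) hlam
  have hsq : Real.sqrt (∑ _j ∈ range (i + 1), C ^ 2) = C * Real.sqrt (i + 1) := by
    rw [sum_const, card_range, nsmul_eq_mul, Real.sqrt_mul' _ (sq_nonneg C), Real.sqrt_sq hC]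
    push_cast
    ring
  have hmean : ∑ j ∈ range (i + 1), ∫ ω', ξ j ω' ∂μ = (i + 1) * m := by
    rw [sum_congr rfl (fun j _ => hx.integral_eq j), sum_const, card_range, nsmul_eq_mul]
    push_cast
    ring
  refine (measure_mono ?_).trans hH
  intro ω hω
  simp only [Set.mem_setOf_eq] at hω ⊢
  rw [hsq, hmean]
  set T := ∑ j ∈ range (i + 1), ξ j ω
  have htri : |T| ≤ |T - (i + 1) * m| + |m| * (i + 1) := by
    calc |T| = |(T - (i + 1) * m) + (i + 1) * m| := by rw [sub_add_cancel]
      _ ≤ |T - (i + 1) * m| + |(i + 1) * m| := abs_add_le _ _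
      _ = |T - (i + 1) * m| + |m| * (i + 1) := by
          rw [abs_mul, abs_of_nonneg (by positivity : (0 : ℝ) ≤ i + 1)]; ring
  linarith

/-- **LEMMA 2.9: a lower bound for sums of random data.** Under Model 2 (mean `μ_w`, constant
`C_w`), if `(1 − α) |μ_w| √(n+1) ≥ λ C_w` then `|Σ_{j=0}^n w_j| ≥ α |μ_w| (n+1)` with probability at
least `1 − 2 exp(−λ²/2)` (Lemma 2.5: `|Σ w_j − (n+1) μ_w| ≤ λ C_w √(n+1)`, and
`|μ_w|(n+1) − λ C_w √(n+1) ≥ α |μ_w| (n+1)`). The source takes `α ∈ [0,1]`; only the displayed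
condition is used. [cite: HighamMary2020, §2.2, Lemma 2.9] -/
theorem Model2.sum_lower_probBound {w : ℕ → Ω → ℝ} {mw Cw : ℝ} (hw : Model2 μ w mw Cw) (n : ℕ)
    {α lam : ℝ} (hlam : 0 ≤ lam) (hcond : lam * Cw ≤ (1 - α) * |mw| * Real.sqrt (n + 1)) :
    μ {ω | |∑ j ∈ range (n + 1), w j ω| < α * |mw| * (n + 1)}
      ≤ ENNReal.ofReal (2 * Real.exp (-lam ^ 2 / 2)) := by
  have hC : 0 ≤ Cw := hw.const_nonneg
  have hH := hoeffding_abs hw.indep hw.measurable (c := fun _ => Cw) (fun j ω => hw.bounded j ω)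
    (range (n + 1)) hlam
  have hsq : Real.sqrt (∑ _j ∈ range (n + 1), Cw ^ 2) = Cw * Real.sqrt (n + 1) := by
    rw [sum_const, card_range, nsmul_eq_mul, Real.sqrt_mul' _ (sq_nonneg Cw), Real.sqrt_sq hC]
    push_cast
    ring
  have hmean : ∑ j ∈ range (n + 1), ∫ ω', w j ω' ∂μ = (n + 1) * mw := by
    rw [sum_congr rfl (fun j _ => hw.integral_eq j), sum_const, card_range, nsmul_eq_mul]
    push_cast
    ring
  have hsqrt1 : Real.sqrt (n + 1) * Real.sqrt (n + 1) = n + 1 :=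
    Real.mul_self_sqrt (by positivity)
  refine (measure_mono ?_).trans hH
  intro ω hω
  simp only [Set.mem_setOf_eq] at hω ⊢
  rw [hsq, hmean]
  set T := ∑ j ∈ range (n + 1), w j ω
  -- `|T − (n+1) μ_w| ≥ (n+1)|μ_w| − |T| > (1 − α)|μ_w|(n+1) ≥ λ C_w √(n+1)`
  have htri : |mw| * (n + 1) ≤ |T - (n + 1) * mw| + |T| := by
    calc |mw| * (n + 1) = |(n + 1) * mw| := by
          rw [abs_mul, abs_of_nonneg (by positivity : (0 : ℝ) ≤ n + 1)]; ring
      _ = |T - (T - (n + 1) * mw)| := by rw [sub_sub_cancel]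
      _ ≤ |T| + |T - (n + 1) * mw| := abs_sub _ _
      _ = |T - (n + 1) * mw| + |T| := add_comm _ _
  have hkey : lam * Cw * Real.sqrt (n + 1) ≤ (1 - α) * |mw| * (n + 1) := by
    calc lam * Cw * Real.sqrt (n + 1) ≤ (1 - α) * |mw| * Real.sqrt (n + 1) * Real.sqrt (n + 1) :=
          mul_le_mul_of_nonneg_right hcond (Real.sqrt_nonneg _)
      _ = (1 - α) * |mw| * (n + 1) := by rw [mul_assoc, hsqrt1]
  nlinarith

end Hoeffding

/-! ### LEMMA 2.7: the first-order error `E_n = Σ_k T_k δ_k` is a martingale; its probabilistic bound -/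

section FirstOrder

variable [IsProbabilityMeasure μ] {u : ℝ} {δ ξ : ℕ → Ω → ℝ} {m C : ℝ}

/-- The CANDIDATE BOUNDS `c_k / u` for the increments `T_k δ_k` of `E_k`: `A_0 = 0` and
`A_k = |μ_x| (k+1) + λ C_x √(k+1)` for the partial sum `T_k` of `k + 1` summands (`k ≥ 1`), each
valid with probability `≥ 1 − 2 exp(−λ²/2)` by Lemma 2.6.
[cite: HighamMary2020, §2.2, Lemma 2.7, proof (`|T_k| u ≤ (|μ_x| k + λ C_x √k) u =: c_k`)] -/
noncomputable def tBound (m C lam : ℝ) : ℕ → ℝ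
  | 0 => 0
  | k + 1 => |m| * (k + 2) + lam * C * Real.sqrt (k + 2)

/-- `A_k ≥ 0` (for `λ, C ≥ 0`). [cite: HighamMary2020, §2.2, Lemma 2.7, proof (`c_k`)] -/
theorem tBound_nonneg {lam : ℝ} (hlam : 0 ≤ lam) (hC : 0 ≤ C) (m : ℝ) : ∀ k, 0 ≤ tBound m C lam k
  | 0 => le_rfl
  | k + 1 => by unfold tBound; positivity

/-- The candidate bounds increase: `A_k ≤ |μ_x| (n+1) + λ C_x √(n+1)` for `k ≤ n` (so
`Σ_{k≤n} c_k² ≤ n c_n²`). [cite: HighamMary2020, §2.2, Lemma 2.7, proof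
(`|E_n| ≤ λ √(n−1) c_n`)] -/
theorem tBound_le {lam : ℝ} (hlam : 0 ≤ lam) (hC : 0 ≤ C) (m : ℝ) {k n : ℕ} (hk : k ≤ n) :
    tBound m C lam k ≤ |m| * (n + 1) + lam * C * Real.sqrt (n + 1) := by
  cases k with
  | zero => show (0 : ℝ) ≤ _; positivity
  | succ j =>
      unfold tBound
      have h1 : (j : ℝ) + 2 ≤ n + 1 := by exact_mod_cast (show j + 2 ≤ n + 1 by omega)
      have h2 : Real.sqrt (j + 2) ≤ Real.sqrt (n + 1) := Real.sqrt_le_sqrt h1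
      have h3 : 0 ≤ lam * C := mul_nonneg hlam hC
      nlinarith [abs_nonneg m]

/-- The variance proxy of the Azuma–Hoeffding step of Lemma 2.7:
`Σ_{k≤n} (A_k u)² ≤ n ((|μ_x|(n+1) + λ C_x √(n+1)) u)²`.
[cite: HighamMary2020, §2.2, Lemma 2.7, proof (`(Σ_k c_k²)^{1/2} ≤ √(n−1) c_n`)] -/
theorem sum_sq_tBound_mul_le {lam : ℝ} (hlam : 0 ≤ lam) (hC : 0 ≤ C) (hu : 0 ≤ u) (m : ℝ) (n : ℕ) :
    ∑ k ∈ range (n + 1), (tBound m C lam k * u) ^ 2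
      ≤ n * ((|m| * (n + 1) + lam * C * Real.sqrt (n + 1)) * u) ^ 2 := by
  set M := (|m| * (n + 1) + lam * C * Real.sqrt (n + 1)) * u with hM
  have hterm : ∀ k ∈ range n, (tBound m C lam (k + 1) * u) ^ 2 ≤ M ^ 2 := by
    intro k hk
    have hk' : k + 1 ≤ n := mem_range.mp hk
    have h0 : 0 ≤ tBound m C lam (k + 1) * u := mul_nonneg (tBound_nonneg hlam hC m _) hu
    exact pow_le_pow_left₀ h0 (mul_le_mul_of_nonneg_right (tBound_le hlam hC m hk') hu) 2
  calc ∑ k ∈ range (n + 1), (tBound m C lam k * u) ^ 2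
      = ∑ k ∈ range n, (tBound m C lam (k + 1) * u) ^ 2 := by
        rw [sum_range_succ']; simp [tBound]
    _ ≤ ∑ k ∈ range n, M ^ 2 := sum_le_sum hterm
    _ = n * M ^ 2 := by rw [sum_const, card_range, nsmul_eq_mul]

/-- [folklore] `|clip_c(t)| ≤ c` for `c ≥ 0`. -/
private theorem abs_clip_le {c : ℝ} (hc : 0 ≤ c) (t : ℝ) : |clip c t| ≤ c := by
  unfold clip
  rw [abs_le]
  exact ⟨le_max_left _ _, max_le (by linarith) (min_le_right _ _)⟩

/-- [folklore] `clip_c(t) = t` when `|t| ≤ c`. -/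
private theorem clip_eq_self {c t : ℝ} (h : |t| ≤ c) : clip c t = t := by
  unfold clip
  rw [abs_le] at h
  rw [min_eq_left h.2, max_eq_right h.1]

/-- [folklore] `clip_c` is measurable. -/
private theorem measurable_clip (c : ℝ) : Measurable (clip c) :=
  measurable_const.max (measurable_id.min measurable_const)

/-- [folklore] the data partial sums `T_k = dataCoef e k` are measurable functions of the data vector. -/
private theorem measurable_dataCoef (k : ℕ) : Measurable (fun e : ℕ → ℝ => dataCoef e k) := by
  cases k with
  | zero => exact measurable_const
  | succ k =>
      show Measurable (fun e : ℕ → ℝ => ∑ i ∈ range (k + 2), e i)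
      exact Finset.measurable_sum _ (fun i _ => measurable_pi_apply i)

/-- [folklore] the Azuma–Hoeffding radius at failure probability `2 exp(−λ²/2)` is `λ (Σ c_k²)^{1/2}`. -/
private theorem azumaRadius_two_mul_exp (σsq : ℝ) {lam : ℝ} (hlam : 0 ≤ lam) :
    azumaRadius σsq (2 * Real.exp (-lam ^ 2 / 2)) = Real.sqrt σsq * lam := by
  unfold azumaRadius
  congr 1
  have h2p : 2 / (2 * Real.exp (-lam ^ 2 / 2)) = Real.exp (lam ^ 2 / 2) := by
    rw [show -lam ^ 2 / 2 = -(lam ^ 2 / 2) by ring, Real.exp_neg]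
    field_simp
  rw [h2p, Real.log_exp, show 2 * (lam ^ 2 / 2) = lam ^ 2 by ring, Real.sqrt_sq hlam]

/-- **LEMMA 2.7 (the martingale `E_k = Σ_{i≤k} T_i δ_i`), sharp form of the proof.** If the data
satisfy Model 2 (mean `μ_x`, constant `C_x`) and the rounding errors satisfy Model 3, then
`|E_n| ≤ λ √n (|μ_x| (n+1) + λ C_x √(n+1)) u` fails with probability at most
`2(n+1) exp(−λ²/2)` (`n` Lemma-2.6 events for `T_1, …, T_n`, plus the Azuma–Hoeffding event).
Proof: the rounding errors rescaled by `clip_{A_k}(T_k)/A_k` satisfy Model 1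
(`Model3.srErrorModel_mul`), the transform `Σ_k A_k (clip_{A_k}(T_k)/A_k) δ_k` has sure increment
bounds `A_k u` and coincides with `E_n` whenever every `|T_k| ≤ A_k`; then
`HallmanIpsen2023.azumaHoeffding`. (Source indexing: `λ √(n−1) (|μ_x| n + λ C_x √n) u`,
probability `1 − 2n exp(−λ²/2)`.) [cite: HighamMary2020, §2.2, Lemma 2.7, proof (display
`|E_n| ≤ λ √(n−1) c_n = λ √(n−1) (|μ_x| n + λ C_x √n) u`)] -/
theorem firstOrder_probBound_sharp (hx : Model2 μ ξ m C) (hδ : Model3 μ u δ ξ) (n : ℕ) {lam : ℝ}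
    (hlam : 0 < lam) :
    μ {ω | lam * Real.sqrt n * (|m| * (n + 1) + lam * C * Real.sqrt (n + 1)) * u
        < |∑ k ∈ range (n + 1), dataCoef (fun j => ξ j ω) k * δ k ω|}
      ≤ ENNReal.ofReal (2 * (n + 1) * Real.exp (-lam ^ 2 / 2)) := by
  have hC : 0 ≤ C := hx.const_nonneg
  have hu : 0 ≤ u := hδ.u_nonneg
  have hl : 0 ≤ lam := hlam.le
  set A : ℕ → ℝ := tBound m C lam with hA
  have hA0 : ∀ k, 0 ≤ A k := tBound_nonneg hl hC m
  -- the rescaling factors `ψ_k = clip_{A_k}(T_k)/A_k` (`0` if `A_k = 0`), functions of the data only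
  set F : ℕ → (ℕ → ℝ) × (ℕ → ℝ) → ℝ :=
    fun k p => if A k = 0 then 0 else clip (A k) (dataCoef p.2 k) / A k with hF
  set ψ : ℕ → Ω → ℝ := fun k ω => F k (fun i => δ i ω, fun j => ξ j ω) with hψ
  have hFm : ∀ k, Measurable (F k) := by
    intro k
    by_cases hk : A k = 0
    · simp only [hF, hk, if_true]; exact measurable_const
    · simp only [hF, hk, if_false]
      exact (((measurable_clip (A k)).comp ((measurable_dataCoef k).comp measurable_snd))).div_const _
  have hFdep : ∀ k v w e, (∀ i < k, v i = w i) → F k (v, e) = F k (w, e) := fun _ _ _ _ _ => rfl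
  have hFbd : ∀ k p, |F k p| ≤ 1 := by
    intro k p
    by_cases hk : A k = 0
    · simp [hF, hk]
    · simp only [hF, hk, if_false]
      have hAk : 0 < A k := lt_of_le_of_ne (hA0 k) (Ne.symm hk)
      rw [abs_div, abs_of_pos hAk, div_le_one hAk]
      exact abs_clip_le hAk.le _
  have hSR : SRErrorModel μ u (fun k ω => ψ k ω * δ k ω) :=
    hδ.srErrorModel_mul hFm hFdep hFbd (fun _ _ => rfl)
  -- constant (hence predictable) coefficients `A_k`, sure bounds `|A_k| ≤ A_k`
  have hP : IsPredictable (fun k ω => ψ k ω * δ k ω) (fun k _ => A k) :=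
    fun k => ⟨fun _ => A k, measurable_const, fun _ _ _ => rfl, fun _ => rfl⟩
  have hbd : ∀ k ω, |(fun k (_ : Ω) => A k) k ω| ≤ A k := fun k _ => by
    simp only [abs_of_nonneg (hA0 k)]; exact le_rfl
  set p : ℝ := 2 * Real.exp (-lam ^ 2 / 2) with hp
  have hp0 : 0 < p := by positivity
  set σsq : ℝ := ∑ k ∈ range (n + 1), (A k * u) ^ 2 with hσ
  have hAz := azumaHoeffding hSR hP hbd (n + 1) hp0
  -- on the event "every `|T_k| ≤ A_k`" the clipped transform is `E_n`
  set good : Set Ω := {ω | ∀ k < n + 1, |dataCoef (fun j => ξ j ω) k| ≤ A k} with hgood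
  have hident : ∀ ω ∈ good, transform (fun k _ => A k) (fun k ω => ψ k ω * δ k ω) (n + 1) ω
      = ∑ k ∈ range (n + 1), dataCoef (fun j => ξ j ω) k * δ k ω := by
    intro ω hω
    unfold transform
    refine sum_congr rfl (fun k hk => ?_)
    have hTk := hω k (mem_range.mp hk)
    by_cases hAk : A k = 0
    · have hT0 : dataCoef (fun j => ξ j ω) k = 0 := abs_nonpos_iff.mp (hAk ▸ hTk)
      simp [hψ, hF, hAk, hT0]
    · simp only [hψ, hF, hAk, if_false]
      rw [clip_eq_self hTk]
      field_simp
  -- the bad event: some `T_k`, `1 ≤ k ≤ n`, exceeds its Lemma-2.6 bound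
  have hbad : μ goodᶜ ≤ ENNReal.ofReal (n * p) := by
    have hsub : goodᶜ ⊆ ⋃ k ∈ range n, {ω | A (k + 1) < |dataCoef (fun j => ξ j ω) (k + 1)|} := by
      intro ω hω
      simp only [hgood, Set.mem_compl_iff, Set.mem_setOf_eq, not_forall, not_le] at hω
      obtain ⟨k, hk, hlt⟩ := hω
      cases k with
      | zero => simp [dataCoef, hA, tBound] at hlt
      | succ j =>
          simp only [Set.mem_iUnion, Set.mem_setOf_eq, mem_range]
          exact ⟨j, by omega, hlt⟩
    have hk1 : ∀ k ∈ range n,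
        μ {ω | A (k + 1) < |dataCoef (fun j => ξ j ω) (k + 1)|} ≤ ENNReal.ofReal p := by
      intro k _
      have h26 := hx.partialSum_probBound (k + 1) hl
      simp only [hA, tBound, dataCoef]
      refine le_of_eq_of_le ?_ h26
      congr 1
      ext ω
      simp only [Set.mem_setOf_eq]
      push_cast
      ring_nf
    calc μ goodᶜ ≤ μ (⋃ k ∈ range n, {ω | A (k + 1) < |dataCoef (fun j => ξ j ω) (k + 1)|}) :=
          measure_mono hsub
      _ ≤ ∑ k ∈ range n, μ {ω | A (k + 1) < |dataCoef (fun j => ξ j ω) (k + 1)|} :=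
          measure_biUnion_finset_le _ _
      _ ≤ ∑ _k ∈ range n, ENNReal.ofReal p := sum_le_sum hk1
      _ = ENNReal.ofReal (n * p) := by
          rw [sum_const, card_range, nsmul_eq_mul, ENNReal.ofReal_mul (Nat.cast_nonneg n),
            ENNReal.ofReal_natCast]
  -- the radius is at most the stated bound
  have hrad : azumaRadius σsq p ≤ lam * Real.sqrt n * (|m| * (n + 1) + lam * C * Real.sqrt (n + 1)) * u := by
    rw [hp, azumaRadius_two_mul_exp σsq hl]
    set M := (|m| * (n + 1) + lam * C * Real.sqrt (n + 1)) * u with hM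
    have hM0 : 0 ≤ M := by positivity
    have hsq : Real.sqrt σsq ≤ Real.sqrt n * M := by
      calc Real.sqrt σsq ≤ Real.sqrt (n * M ^ 2) :=
            Real.sqrt_le_sqrt (sum_sq_tBound_mul_le hl hC hu m n)
        _ = Real.sqrt n * M := by rw [Real.sqrt_mul (Nat.cast_nonneg n), Real.sqrt_sq hM0]
    calc Real.sqrt σsq * lam ≤ Real.sqrt n * M * lam := mul_le_mul_of_nonneg_right hsq hl
      _ = lam * Real.sqrt n * (|m| * (n + 1) + lam * C * Real.sqrt (n + 1)) * u := by
          rw [hM]; ring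
  -- assemble: fail ⊆ bad ∪ (good ∩ Azuma-fail)
  have hsplit : {ω | lam * Real.sqrt n * (|m| * (n + 1) + lam * C * Real.sqrt (n + 1)) * u
        < |∑ k ∈ range (n + 1), dataCoef (fun j => ξ j ω) k * δ k ω|}
      ⊆ goodᶜ ∪ {ω | azumaRadius σsq p
          < |transform (fun k _ => A k) (fun k ω => ψ k ω * δ k ω) (n + 1) ω|} := by
    intro ω hω
    by_cases hg : ω ∈ good
    · right
      simp only [Set.mem_setOf_eq] at hω ⊢
      rw [hident ω hg]
      exact lt_of_le_of_lt hrad hω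
    · left; exact hg
  calc μ {ω | lam * Real.sqrt n * (|m| * (n + 1) + lam * C * Real.sqrt (n + 1)) * u
          < |∑ k ∈ range (n + 1), dataCoef (fun j => ξ j ω) k * δ k ω|}
      ≤ μ (goodᶜ ∪ {ω | azumaRadius σsq p
          < |transform (fun k _ => A k) (fun k ω => ψ k ω * δ k ω) (n + 1) ω|}) :=
        measure_mono hsplit
    _ ≤ μ goodᶜ + μ {ω | azumaRadius σsq p
          < |transform (fun k _ => A k) (fun k ω => ψ k ω * δ k ω) (n + 1) ω|} :=
        measure_union_le _ _
    _ ≤ ENNReal.ofReal (n * p) + ENNReal.ofReal p := add_le_add hbad hAz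
    _ = ENNReal.ofReal (2 * (n + 1) * Real.exp (-lam ^ 2 / 2)) := by
        rw [← ENNReal.ofReal_add (by positivity) hp0.le, hp]
        ring_nf

/-- **LEMMA 2.7 (Higham–Mary 2020), as printed.** Under Models 2 and 3, the first-order error
`E_n = Σ_k T_k δ_k` satisfies `|E_n| ≤ (λ |μ_x| (n+1) √(n+1) + λ² C_x (n+1)) u` with probability at
least `1 − 2(n+1) exp(−λ²/2)` (the sharp form weakened by `√n ≤ √(n+1)` "for readability"; source
indexing `(λ |μ_x| n^{3/2} + λ² C_x n) u`, `1 − 2n exp(−λ²/2)`).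
[cite: HighamMary2020, §2.2, Lemma 2.7] -/
theorem firstOrder_probBound (hx : Model2 μ ξ m C) (hδ : Model3 μ u δ ξ) (n : ℕ) {lam : ℝ}
    (hlam : 0 < lam) :
    μ {ω | (lam * |m| * (n + 1) * Real.sqrt (n + 1) + lam ^ 2 * C * (n + 1)) * u
        < |∑ k ∈ range (n + 1), dataCoef (fun j => ξ j ω) k * δ k ω|}
      ≤ ENNReal.ofReal (2 * (n + 1) * Real.exp (-lam ^ 2 / 2)) := by
  have hC : 0 ≤ C := hx.const_nonneg
  have hu : 0 ≤ u := hδ.u_nonneg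
  have hl : 0 ≤ lam := hlam.le
  refine (measure_mono ?_).trans (firstOrder_probBound_sharp hx hδ n hlam)
  intro ω hω
  simp only [Set.mem_setOf_eq] at hω ⊢
  refine lt_of_le_of_lt ?_ hω
  have h1 : Real.sqrt n ≤ Real.sqrt (n + 1) := Real.sqrt_le_sqrt (by linarith)
  have h2 : Real.sqrt n * Real.sqrt (n + 1) ≤ n + 1 := by
    calc Real.sqrt n * Real.sqrt (n + 1) ≤ Real.sqrt (n + 1) * Real.sqrt (n + 1) :=
          mul_le_mul_of_nonneg_right h1 (Real.sqrt_nonneg _)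
      _ = n + 1 := Real.mul_self_sqrt (by positivity)
  have h3 : 0 ≤ Real.sqrt n := Real.sqrt_nonneg _
  have h4 : 0 ≤ |m| := abs_nonneg m
  -- `λ √n (|m|(n+1) + λ C √(n+1)) u = λ|m|(n+1)√n u + λ² C √n √(n+1) u`
  have h5 : lam * Real.sqrt n * (|m| * (n + 1)) * u ≤ lam * |m| * (n + 1) * Real.sqrt (n + 1) * u := by
    have := mul_le_mul_of_nonneg_left h1 (by positivity : 0 ≤ lam * |m| * (n + 1) * u)
    nlinarith
  have h6 : lam * Real.sqrt n * (lam * C * Real.sqrt (n + 1)) * u ≤ lam ^ 2 * C * (n + 1) * u := by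
    have := mul_le_mul_of_nonneg_left h2 (by positivity : 0 ≤ lam ^ 2 * C * u)
    nlinarith
  nlinarith

end FirstOrder

/-! ### THEOREM 2.8 and COROLLARY 2.10: the error and backward error for random data -/

section Main

variable [IsProbabilityMeasure μ] {u : ℝ} {δ ξ : ℕ → Ω → ℝ} {m C : ℝ}

/-- The SECOND-ORDER TERM of Theorem 2.8 made explicit (the `O(u²)` of (2.14)): the bound
`n ((1+u)^{n−1} − 1) (Σ_i |x_i|) u` of `GeneralData.abs_sum_remCoef_mul_le` with `Σ_{i≤n} |x_i| ≤ (n+1) C_x`,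
i.e. `n (n+1) C_x ((1+u)^{n−1} − 1) u ≤ n² (n+1) C_x u² (1+u)^{n−2}`.
[cite: HighamMary2020, §2.2, Theorem 2.8, eq. (2.14) (the `O(u²)` term; proof: "`|ŝ − s| = |E_n| + O(u²)`
by Lemma 2.1")] -/
noncomputable def secondOrder (u C : ℝ) (n : ℕ) : ℝ := n * (n + 1) * C * ((1 + u) ^ (n - 1) - 1) * u

/-- The second-order term dominates the remainder of Lemma 2.1 for data bounded by `C`.
[cite: HighamMary2020, §2.2, Theorem 2.8, proof ("by Lemma 2.1")] -/
theorem abs_sum_remCoef_mul_le_secondOrder (hu : 0 ≤ u) {x d : ℕ → ℝ} (hd : ∀ k, |d k| ≤ u)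
    (hxC : ∀ i, |x i| ≤ C) (n : ℕ) :
    |∑ k ∈ range (n + 1), remCoef x d k * d k| ≤ secondOrder u C n := by
  have h1 := abs_sum_remCoef_mul_le hu x d hd n
  have h2 : ∑ i ∈ range (n + 1), |x i| ≤ (n + 1) * C := by
    calc ∑ i ∈ range (n + 1), |x i| ≤ ∑ _i ∈ range (n + 1), C := sum_le_sum (fun i _ => hxC i)
      _ = (n + 1) * C := by rw [sum_const, card_range, nsmul_eq_mul]; push_cast; ring
  have h3 : 0 ≤ (1 + u) ^ (n - 1) - 1 := sub_nonneg.mpr (one_le_pow₀ (by linarith))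
  unfold secondOrder
  calc |∑ k ∈ range (n + 1), remCoef x d k * d k|
      ≤ n * (((1 + u) ^ (n - 1) - 1) * ∑ i ∈ range (n + 1), |x i|) * u := h1
    _ ≤ n * (((1 + u) ^ (n - 1) - 1) * ((n + 1) * C)) * u := by gcongr
    _ = n * (n + 1) * C * ((1 + u) ^ (n - 1) - 1) * u := by ring

/-- **THEOREM 2.8 (Higham–Mary 2020): probabilistic error bound for recursive summation of RANDOM
DATA.** Let the data satisfy Model 2 (mean `μ_x`, constant `C_x`) and the rounding errors Model 3.
Then the computed sum `ŝ` of `x_0, …, x_n` satisfies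
`|ŝ − s| ≤ (λ |μ_x| (n+1) √(n+1) + λ² C_x (n+1)) u + n (n+1) C_x ((1+u)^{n−1} − 1) u`
(first-order term + explicit `O(u²)`) with probability at least `1 − 2(n+1) exp(−λ²/2)`: Lemma 2.7
for `E_n` and Lemma 2.1 for `ŝ − s = E_n + O(u²)`. For `μ_x ≠ 0` the error grows like `n^{3/2} u`,
for `μ_x = 0` only like `n u`. (Source indexing: `(λ |μ_x| n^{3/2} + λ² C_x n) u + O(u²)`,
`1 − 2n exp(−λ²/2)`.) [cite: HighamMary2020, §2.2, Theorem 2.8, eq. (2.14)] -/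
theorem recSum_probErrorBound_randomData (hx : Model2 μ ξ m C) (hδ : Model3 μ u δ ξ) (n : ℕ)
    {lam : ℝ} (hlam : 0 < lam) :
    μ {ω | (lam * |m| * (n + 1) * Real.sqrt (n + 1) + lam ^ 2 * C * (n + 1)) * u + secondOrder u C n
        < |recSum (fun j => ξ j ω) (fun i => δ i ω) n - ∑ j ∈ range (n + 1), ξ j ω|}
      ≤ ENNReal.ofReal (2 * (n + 1) * Real.exp (-lam ^ 2 / 2)) := by
  have hu : 0 ≤ u := hδ.u_nonneg
  refine (measure_mono ?_).trans (firstOrder_probBound hx hδ n hlam)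
  intro ω hω
  simp only [Set.mem_setOf_eq] at hω ⊢
  have hdec := recSum_sub_sum_eq_dataCoef_add_remCoef (fun j => ξ j ω) (fun i => δ i ω) n
  have hrem := abs_sum_remCoef_mul_le_secondOrder hu (x := fun j => ξ j ω) (d := fun i => δ i ω)
    (fun k => hδ.bounded k ω) (fun j => hx.bounded j ω) n
  rw [hdec] at hω
  have htri := abs_add_le (∑ k ∈ range (n + 1), dataCoef (fun j => ξ j ω) k * δ k ω)
    (∑ k ∈ range (n + 1), remCoef (fun j => ξ j ω) (fun i => δ i ω) k * δ k ω)
  linarith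

/-- **COROLLARY 2.10 (Higham–Mary 2020): probabilistic BACKWARD ERROR bound for recursive summation
of random data.** Let `x` satisfy Model 2 (mean `μ_x`, constant `C_x`), let `|x|` satisfy Model 2
(mean `μ_|x|`, constant `C'`), and let the rounding errors satisfy Model 3. If `0 < α` and
`(1 − α) μ_|x| √(n+1) ≥ λ C'`, then with probability at least `1 − 2(n+2) exp(−λ²/2)` the computed
sum is `ŝ = Σ_j x_j (1 + θ_j)` with
`|θ_j| ≤ [(λ |μ_x| (n+1) √(n+1) + λ² C_x (n+1)) u + n(n+1) C_x ((1+u)^{n−1} − 1) u] / (α μ_|x| (n+1))`,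
i.e. `ε_bwd(ŝ) ≤ (α μ_|x|)⁻¹ (λ |μ_x| √(n+1) + λ² C_x) u + O(u²)`: the backward error grows at most
like `√n u` when `μ_x ≠ 0` and does not grow with `n` when `μ_x = 0` (Theorem 2.8 for the numerator
of (2.2), Lemma 2.9 with `w = |x|` for the denominator `Σ_j |x_j| ≥ α μ_|x| (n+1)`). (Source
indexing: probability `1 − 2(n+1) exp(−λ²/2)`.)
[cite: HighamMary2020, §2.2, Corollary 2.10] -/
theorem recSum_probBackwardError_randomData (hx : Model2 μ ξ m C) {mabs C' : ℝ}
    (habs : Model2 μ (fun j ω => |ξ j ω|) mabs C') (hδ : Model3 μ u δ ξ) (n : ℕ) {lam α : ℝ}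
    (hlam : 0 < lam) (hα : 0 < α) (hcond : lam * C' ≤ (1 - α) * mabs * Real.sqrt (n + 1)) :
    μ {ω | ¬ IsBackwardSum (range (n + 1)) (fun j => ξ j ω) (recSum (fun j => ξ j ω) (fun i => δ i ω) n)
        (((lam * |m| * (n + 1) * Real.sqrt (n + 1) + lam ^ 2 * C * (n + 1)) * u + secondOrder u C n)
          / (α * mabs * (n + 1)))}
      ≤ ENNReal.ofReal (2 * (n + 2) * Real.exp (-lam ^ 2 / 2)) := by
  have hu : 0 ≤ u := hδ.u_nonneg
  have hC : 0 ≤ C := hx.const_nonneg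
  have hl : 0 ≤ lam := hlam.le
  -- `μ_|x| ≥ 0`, and `|μ_|x|| = μ_|x|`
  have hmabs0 : 0 ≤ mabs := by
    rw [← habs.integral_eq 0]
    exact integral_nonneg (fun ω => abs_nonneg _)
  set N : ℝ := (lam * |m| * (n + 1) * Real.sqrt (n + 1) + lam ^ 2 * C * (n + 1)) * u
    + secondOrder u C n with hN
  have hN0 : 0 ≤ N := by
    have : 0 ≤ (1 + u) ^ (n - 1) - 1 := sub_nonneg.mpr (one_le_pow₀ (by linarith))
    simp only [hN, secondOrder]
    positivity
  set D : ℝ := α * mabs * (n + 1) with hD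
  rcases hmabs0.eq_or_lt with hm0 | hmpos
  · -- degenerate case `μ_|x| = 0`: the condition forces `C' ≤ 0`, so the data vanish identically,
    -- `ŝ = s = 0` and no backward error bound can fail
    have hC' : C' ≤ 0 := by
      have h1 : lam * C' ≤ 0 := by rw [← hm0] at hcond; simpa using hcond
      by_contra hpos
      exact absurd h1 (not_le.mpr (mul_pos hlam (not_le.mp hpos)))
    have hξ0 : ∀ j ω, ξ j ω = 0 := fun j ω =>
      abs_nonpos_iff.mp (le_trans (le_abs_self _) ((habs.bounded j ω).trans hC'))
    have hempty : {ω | ¬ IsBackwardSum (range (n + 1)) (fun j => ξ j ω)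
        (recSum (fun j => ξ j ω) (fun i => δ i ω) n) (N / D)} = ∅ := by
      ext ω
      simp only [Set.mem_setOf_eq, Set.mem_empty_iff_false, iff_false, not_not]
      have hrec : recSum (fun j => ξ j ω) (fun i => δ i ω) n = 0 := by
        have hb := abs_recSum_le hu (fun j => ξ j ω) (fun i => δ i ω) (fun k => hδ.bounded k ω) n
        simp only [hξ0, abs_zero, sum_const_zero, mul_zero] at hb ⊢
        exact abs_nonpos_iff.mp hb
      refine isBackwardSum_of_abs_sub_le (div_nonneg hN0 (by rw [hD, ← hm0]; simp)) ?_
      rw [hrec]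
      simp [hξ0]
    rw [hempty, measure_empty]
    exact bot_le
  · have hDpos : 0 < D := by rw [hD]; positivity
    -- failure ⊆ {N < |ŝ − s|} ∪ {Σ|x_j| < D}
    have hsplit : {ω | ¬ IsBackwardSum (range (n + 1)) (fun j => ξ j ω)
          (recSum (fun j => ξ j ω) (fun i => δ i ω) n) (N / D)}
        ⊆ {ω | N < |recSum (fun j => ξ j ω) (fun i => δ i ω) n - ∑ j ∈ range (n + 1), ξ j ω|}
          ∪ {ω | |(∑ j ∈ range (n + 1), |ξ j ω|)| < α * |mabs| * (n + 1)} := by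
      intro ω hω
      simp only [Set.mem_setOf_eq, Set.mem_union] at hω ⊢
      by_contra hcon
      push Not at hcon
      obtain ⟨h1, h2⟩ := hcon
      rw [abs_of_nonneg hmabs0, abs_of_nonneg (sum_nonneg fun j _ => abs_nonneg (ξ j ω))] at h2
      refine hω (isBackwardSum_of_abs_sub_le (div_nonneg hN0 hDpos.le) (h1.trans ?_))
      calc N = N / D * D := (div_mul_cancel₀ N hDpos.ne').symm
        _ ≤ N / D * ∑ j ∈ range (n + 1), |ξ j ω| :=
            mul_le_mul_of_nonneg_left h2 (div_nonneg hN0 hDpos.le)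
    have hcond' : lam * C' ≤ (1 - α) * |mabs| * Real.sqrt (n + 1) := by
      rwa [abs_of_nonneg hmabs0]
    have h28 := recSum_probErrorBound_randomData hx hδ n hlam
    have h29 := habs.sum_lower_probBound n hl hcond'
    have he : 0 ≤ Real.exp (-lam ^ 2 / 2) := (Real.exp_pos _).le
    calc μ {ω | ¬ IsBackwardSum (range (n + 1)) (fun j => ξ j ω)
            (recSum (fun j => ξ j ω) (fun i => δ i ω) n) (N / D)}
        ≤ μ ({ω | N < |recSum (fun j => ξ j ω) (fun i => δ i ω) n - ∑ j ∈ range (n + 1), ξ j ω|}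
            ∪ {ω | |(∑ j ∈ range (n + 1), |ξ j ω|)| < α * |mabs| * (n + 1)}) := measure_mono hsplit
      _ ≤ μ {ω | N < |recSum (fun j => ξ j ω) (fun i => δ i ω) n - ∑ j ∈ range (n + 1), ξ j ω|}
          + μ {ω | |(∑ j ∈ range (n + 1), |ξ j ω|)| < α * |mabs| * (n + 1)} := measure_union_le _ _
      _ ≤ ENNReal.ofReal (2 * (n + 1) * Real.exp (-lam ^ 2 / 2))
          + ENNReal.ofReal (2 * Real.exp (-lam ^ 2 / 2)) := add_le_add h28 h29
      _ = ENNReal.ofReal (2 * (n + 2) * Real.exp (-lam ^ 2 / 2)) := by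
          rw [← ENNReal.ofReal_add (by positivity) (by positivity)]
          ring_nf

end Main

end Literature.ComputerArithmetic.HighamMary2020
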